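import Literature.NumberTheory.Weil1964.ArchResMixedSpace
import Literature.NumberTheory.GelbartRogawski1991.DoubledWeilRepresentationArchLagrangianGen
import Literature.NumberTheory.GelbartRogawski1991.DoubledUnitarySiegelParabolicAlgebraGen
import Literature.NumberTheory.GelbartRogawski1991.DoubledUnitaryArchSiegelDiagonal
import Literature.NumberTheory.GelbartRogawski1991.DoubledUnitaryArchSiegelModulus
import HarnessLib

/-!
# The archimedean Siegel element `(g, 1)` of the doubled unitary group on diagonal pairs — general `E/F`, `E` totally complex:
# `ι^𝔻(g, 1)` acts on diagonal archimedean pairs through `Res(α_∞)`, `0 < det_ℝ = |det_Δ (g,1)|_{𝔸_E} = modDelta (g,1)²`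

GENERAL-`(F, E, c)` TWIN (namespace `GRConstructionGen`, telescope `(F E c hcδ hδ hd e TV hV hVd TW hW hWd)` of
`DoubledUnitaryGlobalSplittingDataGen`) of the CM trio `DoubledUnitaryArchSiegelDiagonal` + `DoubledUnitaryArchSiegelModulus`
§CM + `DoubledUnitaryArchSiegelDiagonalModulus` (namespace `GRConstruction`: CM field `L ⊃ L⁺`, real places of `L⁺`,
`placeOver`).  Here `F` is ANY number field and `E/F` any quadratic extension with `E` TOTALLY COMPLEX; instead of reading
the action place by place over the real places of `L⁺` (which for a complex place of `F` would need the two places of `E`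
above it), the action is read UNIFORMLY in the mixed space `E ⊗ ℝ = ∏_w E_w` through the quadratic coordinates at `∞`
(`Weil1964/ArchResMixedSpace`: `archPairMixed`, `archResLin`, `det_archResLin = N_{(E⊗ℝ)/ℝ}(det α_∞) = ∏_w |det α_w|²`).

* §1 `archAct (ι^𝔻 p) = archResFun p` (`adelicToSymplectic_reIm`); diagonal bookkeeping (`reIm`, `adeleVecE` of diagonal
  pairs); **`archAct_toSpD_diagPair`** — for `p ∈ P_Δ(𝔸)`, `ι^𝔻(p)` maps the diagonal pair of `(a, z)` to the diagonal
  pair of `archResFun (deltaBlock p) (a, z)` (`α = deltaBlock p = p₁₁ + p₁₂`; `GRConstruction.mulVec_diag_of_blocks` of the CM file);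
* §2 **`modDelta_archToAdelic_sq_eq_prod_normSq`** — `modDelta (g,1)² = |det_Δ (g,1)|_{𝔸_E} = ∏_w |det σ_w(α_w)|²` over the
  (complex) places `w` of `E` (finite part of `det_Δ (g,1)` is `1`, `ArchSplitting.snd_det_deltaBlock_archToAdelic`; every
  archimedean local degree is `2`);
* §3 **`exists_archAct_diagPair_det_eq_modDelta_sq_gen`** — THE `hdiag` INPUT of
  `DoubledWeilRepresentationArchLiftGen.isArchHalf_twist_archLift` at `jA := archToAdelic`: for `g ∈ U(J^𝔻)(F ⊗ ℝ)` with
  `(g, 1) ∈ P_Δ(𝔸)` a real-linear automorphism `A` (`= archResLin (deltaBlock (g,1))`) of the archimedean pairs with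
  `archAct (ι^𝔻 (g,1)) ((a,a),(z,z)) = (((A(a,z))₁, (A(a,z))₁), ((A(a,z))₂, (A(a,z))₂))`, `0 < det A`, `det A = modDelta (g,1)²`.
  Positivity is where `E` totally complex enters: a real place of `E` would contribute a real factor `det α_w` of either
  sign (the type-(ii) places of the GR-2 lineage's plan, not treated here).

([Kudla1994, §3]: `P_Δ = M N`, `m(a)` acts on `Δ ≅ Eⁿ` through `a`, `|x(m(a))| = |det a|`; [HarrisKudlaSweet1996, §1 (1.15)]:
`ω(m(a)) φ(x) = χ(det a) |det a|^{m/2} φ(x a)`; archimedean places of the kernel construction of [GelbartRogawski1991,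
Prop. 3.1.1].)  Written for the stage-1 cell `pub-hodgecm` (seat GR-1, on the «TAKE hdiag-gen» of seat GR-2); KERNEL only:
proved theorems; no definition, no named fact, no `sorry`.  Nothing here is a claim of the manuscripts adjudicated by that cell.

## References

* S. S. Kudla, *Splitting metaplectic covers of dual reductive pairs*, Israel J. Math. 87 (1994) 361–401, §3 [Kudla1994].
* M. Harris, S. S. Kudla, W. J. Sweet, *Theta dichotomy for unitary groups*, J. Amer. Math. Soc. 9 (1996), §1 [HarrisKudlaSweet1996].
* S. Gelbart, J. Rogawski, Invent. Math. 105 (1991), §3.1 Prop. 3.1.1 p. 455 [GelbartRogawski1991].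
* J. Tate, *Fourier analysis in number fields and Hecke's zeta-functions* (1950/1967), §4.3 [TateThesis1967].
-/

set_option autoImplicit false

noncomputable section

open scoped Classical
open scoped Matrix
open NumberField NumberField.InfinitePlace NumberField.mixedEmbedding IsDedekindDomain
open Literature.NumberTheory.Automorphic Literature.NumberTheory.Automorphic.UnitaryGroup
open Literature.NumberTheory.Weil1964
open Literature.NumberTheory.GaloisRepresentations
open Literature.RepresentationTheory.HeisenbergGroup

namespace Literature.NumberTheory.GelbartRogawski1991.GRConstructionGen

open UnitaryDualPair QuadraticCoordinates

variable (F : Type) [Field F] [NumberField F] (E : Type) [Field E] [NumberField E] [Algebra F E]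
  [Algebra.IsQuadraticExtension F E]
variable (c : E ≃ₐ[F] E) {δ : E} (hcδ : c δ = -δ) (hδ : δ ≠ 0) {d : F} (hd : δ * δ = algebraMap F E d)
variable {N M n : ℕ} (e : Fin N × Fin M ≃ Fin n)
  (TV : Matrix (Fin N) (Fin N) F) (hV : TV.IsSymm) (hVd : IsUnit TV.det)
  (TW : Matrix (Fin M) (Fin M) F) (hW : TW.IsSymm) (hWd : IsUnit TW.det)

/-! ## §1 `ι^𝔻(p)` on archimedean pairs is `archResFun p`; diagonal pairs, `p ∈ P_Δ(𝔸)` -/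


omit [NumberField F] [NumberField E] [Algebra.IsQuadraticExtension F E] in
/-- the `E`-adelic vector of a doubled diagonal pair is the doubled `E`-adelic vector. [cite: Kudla1994, §3] -/
theorem adeleVecE_diagPair [NumberField F] [NumberField E] [Algebra.IsQuadraticExtension F E]
    (az : (Fin n → mixedSpace F) × (Fin n → mixedSpace F)) :
    adeleVecE F E c hcδ hδ (Fin (n + n))
        (Sum.elim az.1 az.1 ∘ ⇑(e₂ (n := n)).symm, Sum.elim az.2 az.2 ∘ ⇑(e₂ (n := n)).symm) =
      Sum.elim (adeleVecE F E c hcδ hδ (Fin n) az) (adeleVecE F E c hcδ hδ (Fin n) az) ∘ ⇑(e₂ (n := n)).symm := by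
  unfold adeleVecE
  dsimp only
  rw [archVec_diag, archVec_diag]
  funext j
  rw [reIm_symm_apply]
  simp only [Function.comp_apply]
  rcases (e₂ (n := n)).symm j with i | i <;> rfl

include hd hV hW in
omit [NumberField E] in
/-- **`archAct (ι^𝔻 p) = archResFun p`**: the archimedean action of `ι^𝔻(p)`, `p ∈ H(𝔸)`, on archimedean pairs is the
archimedean restriction-of-scalars action of the adelic matrix of `p` (`adelicToSymplectic_reIm`).
[cite: GelbartRogawski1991, §3.1 p. 454] -/
theorem archAct_toSpD_eq_archResFun [NumberField E] (p : HA F E c e TV TW)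
    (ab : (Fin (n + n) → mixedSpace F) × (Fin (n + n) → mixedSpace F)) :
    archAct (gramDA F e TV TW) (toSpD F E c hcδ hδ hd e TV hV TW hW p) ab =
      archResFun F E c hcδ hδ (Fin (n + n))
        ((p : GL (Fin (n + n)) (AdeleRing (𝓞 E) E)) : Matrix (Fin (n + n)) (Fin (n + n)) (AdeleRing (𝓞 E) E)) ab := by
  have h : (toSpD F E c hcδ hδ hd e TV hV TW hW p).1
      (reIm (quadraticAdeleEquiv F E c hcδ hδ).toAddEquiv (Fin (n + n)) (adeleVecE F E c hcδ hδ (Fin (n + n)) ab)) =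
      reIm (quadraticAdeleEquiv F E c hcδ hδ).toAddEquiv (Fin (n + n))
        (((p : GL (Fin (n + n)) (AdeleRing (𝓞 E) E)) : Matrix (Fin (n + n)) (Fin (n + n)) (AdeleRing (𝓞 E) E)) *ᵥ
          adeleVecE F E c hcδ hδ (Fin (n + n)) ab) :=
    adelicToSymplectic_reIm F E c (n + n) hcδ hδ hd (gramD_isSymm F e TV hV TW hW) (J := hermD F E e TV TW) rfl p _
  unfold archAct archResFun
  rw [← reIm_adeleVecE F E c hcδ hδ (Fin (n + n)) ab, h]

include hd hV hW in
omit [NumberField E] in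
/-- **`ι^𝔻(p)` maps diagonal archimedean pairs to diagonal pairs through `Res(α)`, `α = deltaBlock p`**: for `p ∈ P_Δ(𝔸)` and
archimedean `a, z ∈ (F ⊗ ℝ)ⁿ`,
`archAct (ι^𝔻 p) ((a,a),(z,z)) = (((B(a,z))₁, (B(a,z))₁), ((B(a,z))₂, (B(a,z))₂))` with `B = archResFun (deltaBlock p)`.
[cite: Kudla1994, §3] [cite: GelbartRogawski1991, §3.1 p. 454] -/
theorem archAct_toSpD_diagPair [NumberField E] (p : HA F E c e TV TW) (hS : IsSiegelDelta F E c e TV TW p)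
    (az : (Fin n → mixedSpace F) × (Fin n → mixedSpace F)) :
    archAct (gramDA F e TV TW) (toSpD F E c hcδ hδ hd e TV hV TW hW p)
        (Sum.elim az.1 az.1 ∘ ⇑(e₂ (n := n)).symm, Sum.elim az.2 az.2 ∘ ⇑(e₂ (n := n)).symm) =
      (Sum.elim (archResFun F E c hcδ hδ (Fin n) (deltaBlock F E c e TV TW p) az).1
          (archResFun F E c hcδ hδ (Fin n) (deltaBlock F E c e TV TW p) az).1 ∘ ⇑(e₂ (n := n)).symm,
        Sum.elim (archResFun F E c hcδ hδ (Fin n) (deltaBlock F E c e TV TW p) az).2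
          (archResFun F E c hcδ hδ (Fin n) (deltaBlock F E c e TV TW p) az).2 ∘ ⇑(e₂ (n := n)).symm) := by
  rw [archAct_toSpD_eq_archResFun F E c hcδ hδ hd e TV hV TW hW p]
  unfold archResFun
  -- `p (V, V) = (α V, α V)` on the doubled diagonal (the CM file's `mulVec_diag_of_blocks`, any commutative ring)
  have hmul : ((p : GL (Fin (n + n)) (AdeleRing (𝓞 E) E)) : Matrix (Fin (n + n)) (Fin (n + n)) (AdeleRing (𝓞 E) E)) *ᵥ
        (Sum.elim (adeleVecE F E c hcδ hδ (Fin n) az) (adeleVecE F E c hcδ hδ (Fin n) az) ∘ ⇑(e₂ (n := n)).symm) =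
      Sum.elim (deltaBlock F E c e TV TW p *ᵥ adeleVecE F E c hcδ hδ (Fin n) az)
        (deltaBlock F E c e TV TW p *ᵥ adeleVecE F E c hcδ hδ (Fin n) az) ∘ ⇑(e₂ (n := n)).symm :=
    GRConstruction.mulVec_diag_of_blocks _ hS _
  -- `reIm` of a doubled diagonal vector is the pair of doubled diagonal vectors
  have hre : ∀ W : Fin n → AdeleRing (𝓞 E) E,
      reIm (quadraticAdeleEquiv F E c hcδ hδ).toAddEquiv (Fin (n + n)) (Sum.elim W W ∘ ⇑(e₂ (n := n)).symm) =
        (Sum.elim (reIm (quadraticAdeleEquiv F E c hcδ hδ).toAddEquiv (Fin n) W).1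
            (reIm (quadraticAdeleEquiv F E c hcδ hδ).toAddEquiv (Fin n) W).1 ∘ ⇑(e₂ (n := n)).symm,
          Sum.elim (reIm (quadraticAdeleEquiv F E c hcδ hδ).toAddEquiv (Fin n) W).2
            (reIm (quadraticAdeleEquiv F E c hcδ hδ).toAddEquiv (Fin n) W).2 ∘ ⇑(e₂ (n := n)).symm) := by
    intro W
    refine Prod.ext (funext fun j => ?_) (funext fun j => ?_)
    · rw [reIm_apply_fst]
      simp only [Function.comp_apply]
      rcases (e₂ (n := n)).symm j with i | i <;> rfl
    · rw [reIm_apply_snd]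
      simp only [Function.comp_apply]
      rcases (e₂ (n := n)).symm j with i | i <;> rfl
  rw [adeleVecE_diagPair, hmul, hre]
  dsimp only
  rw [piArch_sumElim, piArch_sumElim]

/-! ## §2 The idelic modulus `|det_Δ (g,1)|_{𝔸_E}` for `E` totally complex -/

omit [NumberField F] [Algebra.IsQuadraticExtension F E] in
/-- **`|(y, 1)|_{𝔸_E} = ∏_w ‖σ_w(y_w)‖²`** over the (complex) places `w` of the totally complex field `E`
(every local degree is `2`; `σ_w` is an isometry). [cite: TateThesis1967, §4.3] -/
theorem prod_norm_pow_mult_eq_prod_normSq [IsTotallyComplex E] (y : InfiniteAdeleRing E) :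
    ∏ w : InfinitePlace E, ‖y w‖ ^ w.mult =
      ∏ w : {w : InfinitePlace E // w.IsComplex}, Complex.normSq (Completion.extensionEmbedding w.1 (y w.1)) := by
  refine (Fintype.prod_equiv (Equiv.subtypeUnivEquiv fun w : InfinitePlace E => IsTotallyComplex.isComplex w)
    _ _ fun w => ?_).symm
  rw [Equiv.subtypeUnivEquiv_apply, IsTotallyComplex.mult_eq, Complex.normSq_eq_norm_sq,
    (Completion.isometry_extensionEmbedding w.1).norm_map_of_map_zero (map_zero _)]

omit [Algebra.IsQuadraticExtension F E] in
/-- **`modDelta (g,1)² = ∏_w |det σ_w(α_w)|²`** (`E` totally complex): the idelic modulus `|det_Δ (g,1)|_{𝔸_E}` of the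
archimedean Siegel element is the product over the places `w` of `E` of `|det σ_w(α_w)|²`, `α = (g,1)₁₁ + (g,1)₁₂ = deltaBlock (g,1)`
(its finite part is `1`). [cite: Kudla1994, §3] [cite: HarrisKudlaSweet1996, §1 (1.15)] -/
theorem modDelta_archToAdelic_sq_eq_prod_normSq [IsTotallyComplex E]
    (g : arch F E c (n + n) (hermD F E e TV TW))
    (hu : IsUnit (detDelta F E c e TV TW (UnitaryGroup.archToAdelic F E c (n + n) (hermD F E e TV TW) g))) :
    modDelta F E c e TV TW (UnitaryGroup.archToAdelic F E c (n + n) (hermD F E e TV TW) g) ^ 2 =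
      ∏ w : {w : InfinitePlace E // w.IsComplex},
        Complex.normSq (adeleMatAt E (Fin n) w (deltaBlock F E c e TV TW
          (UnitaryGroup.archToAdelic F E c (n + n) (hermD F E e TV TW) g))).det := by
  set p := UnitaryGroup.archToAdelic F E c (n + n) (hermD F E e TV TW) g with hp
  have hval : ((hu.unit : ideleGroup E) : AdeleRing (𝓞 E) E) = detDelta F E c e TV TW p := IsUnit.unit_spec hu
  have h2 : (detDelta F E c e TV TW p).2 = 1 :=
    UnitaryDualPair.ArchSplitting.snd_det_deltaBlock_archToAdelic F E c (hermD F E e TV TW) g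
  have hmod : ideleNorm hu.unit =
      ∏ w : {w : InfinitePlace E // w.IsComplex},
        Complex.normSq (adeleMatAt E (Fin n) w (deltaBlock F E c e TV TW p)).det := by
    unfold ideleNorm
    rw [hval, h2, finprod_eq_one_of_forall_eq_one fun v => by rw [show (1 : FiniteAdeleRing (𝓞 E) E) v = 1 from rfl, norm_one],
      mul_one, prod_norm_pow_mult_eq_prod_normSq]
    refine Finset.prod_congr rfl fun w _ => ?_
    rw [← adeleAt_apply, detDelta, RingHom.map_det, RingHom.mapMatrix_apply]
    rfl
  unfold modDelta
  rw [dif_pos hu, hmod]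
  exact Real.sq_sqrt (Finset.prod_nonneg fun w _ => Complex.normSq_nonneg _)

/-! ## §3 The `hdiag` input: `A = archResLin (deltaBlock (g,1))`, `0 < det A = modDelta (g,1)²` -/

include hd hV hW in
/-- **The archimedean Siegel parabolic acts on the diagonal through `Res(α)`, with `0 < det_ℝ = |det_Δ|_{𝔸_E}`** — general
quadratic `E/F` with `E` totally complex (the `hdiag` binder of `DoubledWeilRepresentationArchLiftGen.isArchHalf_twist_archLift`
at `jA := archToAdelic`).  For `g ∈ U(J^𝔻)(F ⊗ ℝ)` with `(g, 1) ∈ P_Δ(𝔸)` there is a real-linear automorphism `A` of the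
archimedean pairs `(a, z) ∈ (F ⊗ ℝ)ⁿ × (F ⊗ ℝ)ⁿ` (namely `A = archResLin (deltaBlock (g,1)) = Res_{(E⊗ℝ)/ℝ}(α_∞)` in the quadratic
coordinates at `∞`) such that `ι^𝔻(g, 1)` maps the diagonal pair of `(a, z)` to the diagonal pair of `A (a, z)`, `0 < det A`,
and `det A = |det_Δ (g,1)|_{𝔸_E} = modDelta (g,1)²` (`det A = N_{(E⊗ℝ)/ℝ}(det α_∞) = ∏_w |det α_w|²`; `det_Δ (g,1)` is a unit on
`P_Δ`, `isUnit_detDelta_of_isSiegelDelta`).  CM case: `GRConstruction.exists_archAct_diagPair_det_eq_modDelta_sq`.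
[cite: Kudla1994, §3] [cite: HarrisKudlaSweet1996, §1 (1.15)] [cite: GelbartRogawski1991, §3.1 Prop. 3.1.1 p. 455 L1–2] -/
theorem exists_archAct_diagPair_det_eq_modDelta_sq_gen [IsTotallyComplex E]
    (g : arch F E c (n + n) (hermD F E e TV TW))
    (hS : IsSiegelDelta F E c e TV TW (UnitaryGroup.archToAdelic F E c (n + n) (hermD F E e TV TW) g)) :
    ∃ A : ((Fin n → mixedSpace F) × (Fin n → mixedSpace F)) ≃ₗ[ℝ]
        ((Fin n → mixedSpace F) × (Fin n → mixedSpace F)),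
      (∀ az : (Fin n → mixedSpace F) × (Fin n → mixedSpace F),
        archAct (gramDA F e TV TW)
            (toSpD F E c hcδ hδ hd e TV hV TW hW (UnitaryGroup.archToAdelic F E c (n + n) (hermD F E e TV TW) g))
            (Sum.elim az.1 az.1 ∘ ⇑(e₂ (n := n)).symm, Sum.elim az.2 az.2 ∘ ⇑(e₂ (n := n)).symm) =
          (Sum.elim (A az).1 (A az).1 ∘ ⇑(e₂ (n := n)).symm, Sum.elim (A az).2 (A az).2 ∘ ⇑(e₂ (n := n)).symm)) ∧
      0 < LinearMap.det (A : ((Fin n → mixedSpace F) × (Fin n → mixedSpace F)) →ₗ[ℝ]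
        ((Fin n → mixedSpace F) × (Fin n → mixedSpace F))) ∧
      ((LinearMap.det (A : ((Fin n → mixedSpace F) × (Fin n → mixedSpace F)) →ₗ[ℝ]
          ((Fin n → mixedSpace F) × (Fin n → mixedSpace F))) : ℝ) : ℂ) =
        ((modDelta F E c e TV TW (UnitaryGroup.archToAdelic F E c (n + n) (hermD F E e TV TW) g) : ℝ) : ℂ) ^ 2 := by
  set p := UnitaryGroup.archToAdelic F E c (n + n) (hermD F E e TV TW) g with hp
  have hu : IsUnit (detDelta F E c e TV TW p) := isUnit_detDelta_of_isSiegelDelta F E c e TV TW p hS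
  have hdetw : ∀ w : {w : InfinitePlace E // w.IsComplex},
      (adeleMatAt E (Fin n) w (deltaBlock F E c e TV TW p)).det ≠ 0 := by
    intro w
    have h1 : (adeleMatAt E (Fin n) w (deltaBlock F E c e TV TW p)).det = adeleAt E w (detDelta F E c e TV TW p) := by
      unfold adeleMatAt detDelta
      rw [RingHom.map_det, RingHom.mapMatrix_apply]
    rw [h1]
    exact (hu.map (adeleAt E w)).ne_zero
  have hdet := det_archResLin_of_isTotallyComplex F E c hcδ hδ (Fin n) (deltaBlock F E c e TV TW p)
  have hpos : 0 < LinearMap.det (archResLin F E c hcδ hδ (Fin n) (deltaBlock F E c e TV TW p)) :=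
    det_archResLin_pos F E c hcδ hδ (Fin n) (deltaBlock F E c e TV TW p) hdetw
  have hU : IsUnit (archResLin F E c hcδ hδ (Fin n) (deltaBlock F E c e TV TW p)) :=
    (LinearMap.isUnit_iff_isUnit_det _).2 (isUnit_iff_ne_zero.2 hpos.ne')
  refine ⟨LinearMap.GeneralLinearGroup.generalLinearEquiv ℝ _ hU.unit, fun az => ?_, ?_, ?_⟩
  · have hA : (LinearMap.GeneralLinearGroup.generalLinearEquiv ℝ _ hU.unit) az =
        archResLin F E c hcδ hδ (Fin n) (deltaBlock F E c e TV TW p) az := rfl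
    rw [hA, archResLin_apply]
    exact archAct_toSpD_diagPair F E c hcδ hδ hd e TV hV TW hW p hS az
  · rw [LinearMap.GeneralLinearGroup.generalLinearEquiv_to_linearMap, IsUnit.unit_spec]
    exact hpos
  · rw [LinearMap.GeneralLinearGroup.generalLinearEquiv_to_linearMap, IsUnit.unit_spec, hdet, ← Complex.ofReal_pow,
      modDelta_archToAdelic_sq_eq_prod_normSq F E c e TV TW g hu]

end Literature.NumberTheory.GelbartRogawski1991.GRConstructionGen

end
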